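import Summits.CriticalPhenomena.PercolationContinuityZ3.Theorems.Transplant.StarSchemeProcess
import HarnessLib

/-!
# v3′+F1 ENTRY-SEED STAR scheme, generic part 3: the run — the replayed state step by step, frozen data of determined cells
# (design of record: HOME/ENTRY-SEED-STAR.md + lead ruling 13:07Z)

builds on p205010 (kernel theorem, internal audit signed; external expert review pending) — nothing in this file uses p205010.
Lane `prim-bschramm`, seat `prim-bschramm-p2` (generic v3′); helper file (`--supports stmt-CriticalPhenomena-4575`).

* `hst ω n` (the history after `n` steps), `sst ω n` (its replay), `stN_eq_sst`, `mem_opens_some_cons_iff`;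
* the cases of a step (`next_cases_run`, `of_next_some_run`); no probe ⇒ nothing changes (`step_none_run`); a probe along `e` ⇒ the history gains its record
  (`hst_succ_some`, `probeP_record`), `F` gains the revealed edges, the replay is `stUpd` (`step_some_run`), the target is determined afterwards
  (`det_tgt_step_run`), the data of every other cell are unchanged (`data_step_of_ne_run`), determined cells stay determined (`det_mono_run`), and so the
  data of a determined cell are frozen (`data_eq_of_det_run`).
[cite: KozmaNitzan2024, §4 pp. 25–27 (exploration processes; (1)–(5))] [cite: GrimmettPercolation1999, §7.2]
-/

noncomputable section

open MeasureTheory ProbabilityTheory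
open scoped ENNReal Classical

namespace Summit.CriticalPhenomena.PercolationContinuityZ3.Theorems

namespace Transplant

namespace StarScheme

open Literature.Probability.Percolation Literature.Probability.LatticeModels SimpleGraph GadgetSystem ProbeHistory HSiteScheme
open KNCells (vspan mem_vspan_iff vspan_mono)
open KNStar (PConn)
open Literature.Probability.Percolation.KozmaNitzan (opens opens_cons_none opens_cons_some)

variable {V : Type*} [DecidableEq V]

namespace Sch

variable {A : Type*} {G : SimpleGraph V} [G.LocallyFinite] {S : Sch V A}

/-- The scheme's next-probe map is `nextProbe`. [folklore] -/
theorem starScheme_next : (S.starScheme G).E.next = S.nextPr G := rfl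

/-- The scheme's success predicate is `succ`. [folklore] -/
theorem starScheme_succ : (S.starScheme G).succ = S.successOf G := rfl

/-- The scheme's initial edges are `U₀`. [folklore] -/
theorem starScheme_U₀ : (S.starScheme G).U₀ = S.U₀ G := rfl

variable (G S) in
/-- The history of the run after `n` steps. [folklore] -/
abbrev hst (ω : BondConfig V) (n : ℕ) : ProbeHistory V := (S.starScheme G).E.hist n ω

variable (G S) in
/-- The replayed state of the run after `n` steps. [folklore] -/
abbrev sst (ω : BondConfig V) (n : ℕ) : State V A S.Γ.N := S.replay G (S.hst G ω n)

/-- The macro-state of the run is the macro part of the replay. [folklore] -/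
theorem stN_eq_sst (n : ℕ) (ω : BondConfig V) : (S.starScheme G).stN n ω = (S.sst G ω n).st := S.mst_eq_replay G _

/-! ## Recorded open edges along histories -/

omit [DecidableEq V] in
/-- Membership in the recorded open edges after a probe. [folklore] -/
theorem mem_opens_some_cons_iff (r : ProbeRecord V) (h : ProbeHistory V) (x : Sym2 V) :
    x ∈ opens (some r :: h) ↔ x ∈ r.2 ∨ x ∈ opens h := by
  rw [opens_cons_some, Finset.mem_union]

/-! ## The steps of the run -/

/-- **The cases of a step**: no probe, or a valid history with a chosen edge examined by the staged probe. [folklore] -/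
theorem next_cases_run (ω : BondConfig V) (n : ℕ) :
    (S.starScheme G).E.next (S.hst G ω n) = none ∨
      ∃ e, ((S.starScheme G).stN n ω).choice = some e ∧ S.Valid G (S.hst G ω n) e ∧
        (S.starScheme G).E.next (S.hst G ω n) = some (S.probeP G (S.sst G ω n) (S.hst G ω n) e) := by
  rw [starScheme_next]
  cases hP : S.nextPr G (S.hst G ω n) with
  | none => exact Or.inl rfl
  | some P =>
    obtain ⟨e, hc, hV, rfl⟩ := S.nextPr_eq_some G hP
    exact Or.inr ⟨e, by rw [stN_eq_sst]; exact hc, hV, rfl⟩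

/-- If a probe is made then it is the staged examination of the chosen edge after a valid history. [folklore] -/
theorem of_next_some_run {ω : BondConfig V} {n : ℕ} {P : AProbe V} (hP : (S.starScheme G).E.next (S.hst G ω n) = some P) :
    ∃ e, ((S.starScheme G).stN n ω).choice = some e ∧ S.Valid G (S.hst G ω n) e ∧ P = S.probeP G (S.sst G ω n) (S.hst G ω n) e := by
  rw [starScheme_next] at hP
  obtain ⟨e, hc, hV, hPe⟩ := S.nextPr_eq_some G hP
  exact ⟨e, by rw [stN_eq_sst]; exact hc, hV, hPe⟩

/-- No probe: the history gains a `none`. [folklore] -/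
theorem hst_succ_none {ω : BondConfig V} {n : ℕ} (hD : (S.starScheme G).E.next (S.hst G ω n) = none) :
    S.hst G ω (n + 1) = none :: S.hst G ω n := by
  show (S.starScheme G).E.hist (n + 1) ω = _
  rw [AExplorer.hist_succ, (S.starScheme G).E.step_of_none hD]

/-- No probe: `F`, the recorded open edges, the replay and the macro-state are unchanged. [folklore] -/
theorem step_none_run {ω : BondConfig V} {n : ℕ} (hD : (S.starScheme G).E.next (S.hst G ω n) = none) :
    S.F G (S.hst G ω (n + 1)) = S.F G (S.hst G ω n) ∧ opens (S.hst G ω (n + 1)) = opens (S.hst G ω n) ∧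
      S.sst G ω (n + 1) = S.sst G ω n ∧ (S.starScheme G).stN (n + 1) ω = (S.starScheme G).stN n ω := by
  have h1 := hst_succ_none hD
  refine ⟨by rw [h1]; unfold Sch.F; rw [supp_cons_none], by rw [h1, opens_cons_none], ?_, (S.starScheme G).stN_succ_of_next_none hD⟩
  show S.replay G (S.hst G ω (n + 1)) = _
  rw [h1, replay_cons_none]

/-- A probe along `e`: the history gains the probe's record. [folklore] -/
theorem hst_succ_some {ω : BondConfig V} {n : ℕ} {e : Site 2 × MDir}
    (hD : (S.starScheme G).E.next (S.hst G ω n) = some (S.probeP G (S.sst G ω n) (S.hst G ω n) e)) :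
    S.hst G ω (n + 1) = some ((S.probeP G (S.sst G ω n) (S.hst G ω n) e).record ω) :: S.hst G ω n := by
  show (S.starScheme G).E.hist (n + 1) ω = _
  rw [AExplorer.hist_succ, (S.starScheme G).E.step_of_some hD]

/-- The record of the staged probe: the revealed edges and the observation of them. [folklore] -/
theorem probeP_record (ω : BondConfig V) (σ : State V A S.Γ.N) (h : ProbeHistory V) (e : Site 2 × MDir) :
    (S.probeP G σ h e).record ω =
      (S.revealOf G σ h e (obs ω (S.env G σ h e)), (S.probeP G σ h e).read ω) := rfl

/-- The revealed edges of the staged probe lie in its envelope. [folklore] -/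
theorem record_fst_sub_env (ω : BondConfig V) (σ : State V A S.Γ.N) (h : ProbeHistory V) (e : Site 2 × MDir) :
    ((S.probeP G σ h e).record ω).1 ⊆ S.env G σ h e := by
  rw [probeP_record]; exact revealOf_subset_env _

/-- The observation of the staged probe lies in the revealed edges, hence in the envelope. [folklore] -/
theorem read_sub_env (ω : BondConfig V) (σ : State V A S.Γ.N) (h : ProbeHistory V) (e : Site 2 × MDir) :
    (S.probeP G σ h e).read ω ⊆ S.env G σ h e := fun x hx => by
  simp only [AProbe.read, mem_obs_iff] at hx
  exact (S.probeP G σ h e).reveal_subset ω hx.1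

/-- **A probe along `e`**: `F` gains the revealed edges, the recorded open edges gain the observation, the replay is the update `stUpd` by the
observation, and the macro-state is updated by success. [cite: KozmaNitzan2024, §4 p. 27 (E_{i+1}, G_{i+1}, X_{i+1})] -/
theorem step_some_run {ω : BondConfig V} {n : ℕ} {e : Site 2 × MDir} (hc : ((S.starScheme G).stN n ω).choice = some e)
    (hD : (S.starScheme G).E.next (S.hst G ω n) = some (S.probeP G (S.sst G ω n) (S.hst G ω n) e)) :
    S.F G (S.hst G ω (n + 1)) = S.F G (S.hst G ω n) ∪ ((S.probeP G (S.sst G ω n) (S.hst G ω n) e).record ω).1 ∧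
      (∀ x, x ∈ opens (S.hst G ω (n + 1)) ↔ x ∈ (S.probeP G (S.sst G ω n) (S.hst G ω n) e).read ω ∨ x ∈ opens (S.hst G ω n)) ∧
      S.sst G ω (n + 1) = S.stUpd G (S.sst G ω n) (S.hst G ω n) e ((S.probeP G (S.sst G ω n) (S.hst G ω n) e).read ω) ∧
      (S.starScheme G).stN (n + 1) ω = ((S.starScheme G).stN n ω).update e
        (S.succP G (S.sst G ω n) (S.hst G ω n) e ((S.probeP G (S.sst G ω n) (S.hst G ω n) e).read ω)) := by
  have h1 := hst_succ_some hD
  have hc' : (S.sst G ω n).st.choice = some e := by rw [← stN_eq_sst]; exact hc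
  refine ⟨?_, fun x => by rw [h1, mem_opens_some_cons_iff]; rfl, ?_, ?_⟩
  · rw [h1]; unfold Sch.F; rw [supp_cons_some]; ext x; simp only [Finset.mem_union]; tauto
  · show S.replay G (S.hst G ω (n + 1)) = _
    rw [h1, replay_cons_some, hc']
    rfl
  · rw [(S.starScheme G).stN_succ_of_next_some hD, hc]
    rfl

/-- After a probe along `e` the target is determined. [folklore] -/
theorem det_tgt_step_run {ω : BondConfig V} {n : ℕ} {e : Site 2 × MDir} (hc : ((S.starScheme G).stN n ω).choice = some e)
    (hD : (S.starScheme G).E.next (S.hst G ω n) = some (S.probeP G (S.sst G ω n) (S.hst G ω n) e)) :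
    ((S.starScheme G).stN (n + 1) ω).Det (tgt e) := by
  rw [(step_some_run hc hD).2.2.2]; exact HSiteScheme.HState.det_update_tgt _ _ _

/-- The data of a cell other than the target are unchanged by `stUpd`. [folklore] -/
theorem stUpd_data_of_ne (σ : State V A S.Γ.N) (h : ProbeHistory V) (e : Site 2 × MDir) (o : Finset (Sym2 V)) {x : Site 2}
    (hx : x ≠ tgt e) :
    (S.stUpd G σ h e o).anc x = σ.anc x ∧ (S.stUpd G σ h e o).srcs x = σ.srcs x ∧ (S.stUpd G σ h e o).pat x = σ.pat x ∧
      (S.stUpd G σ h e o).ons x = σ.ons x ∧ (S.stUpd G σ h e o).J x = σ.J x := by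
  unfold stUpd
  cases S.eIdx σ e o with
  | none => exact ⟨rfl, rfl, rfl, rfl, rfl⟩
  | some j =>
    exact ⟨Function.update_of_ne hx _ _, Function.update_of_ne hx _ _, Function.update_of_ne hx _ _, Function.update_of_ne hx _ _,
      Function.update_of_ne hx _ _⟩

/-- **The data of the target after a probe whose seed stage succeeded** (chosen candidate `j`): anchor `fib u_j`, wired set `cube u_j δ`,
pattern = the observation, onward set, reached strips. [folklore] -/
theorem stUpd_data_tgt (σ : State V A S.Γ.N) (h : ProbeHistory V) (e : Site 2 × MDir) (o : Finset (Sym2 V)) {j : Fin S.Γ.N}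
    (hj : S.eIdx σ e o = some j) :
    (S.stUpd G σ h e o).anc (tgt e) = S.candA σ e j ∧ (S.stUpd G σ h e o).srcs (tgt e) = S.cubeOf σ e j ∧
      (S.stUpd G σ h e o).pat (tgt e) = o ∧ (S.stUpd G σ h e o).ons (tgt e) = S.onward G h (tgt e) ∧
      (S.stUpd G σ h e o).J (tgt e) = S.reached G σ h e o j := by
  unfold stUpd; rw [hj]
  exact ⟨Function.update_self _ _ _, Function.update_self _ _ _, Function.update_self _ _ _, Function.update_self _ _ _,
    Function.update_self _ _ _⟩

/-- A probe along `e` does not change the data of cells other than the target. [folklore] -/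
theorem data_step_of_ne_run {ω : BondConfig V} {n : ℕ} {e : Site 2 × MDir} (hc : ((S.starScheme G).stN n ω).choice = some e)
    (hD : (S.starScheme G).E.next (S.hst G ω n) = some (S.probeP G (S.sst G ω n) (S.hst G ω n) e)) {x : Site 2} (hx : x ≠ tgt e) :
    (S.sst G ω (n + 1)).anc x = (S.sst G ω n).anc x ∧ (S.sst G ω (n + 1)).srcs x = (S.sst G ω n).srcs x ∧
      (S.sst G ω (n + 1)).pat x = (S.sst G ω n).pat x ∧ (S.sst G ω (n + 1)).ons x = (S.sst G ω n).ons x ∧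
      (S.sst G ω (n + 1)).J x = (S.sst G ω n).J x := by
  rw [(step_some_run hc hD).2.2.1]; exact stUpd_data_of_ne _ _ _ _ hx

/-- Determined cells stay determined. [folklore] -/
theorem det_mono_run {ω : BondConfig V} {x : Site 2} {m : ℕ} (hx : ((S.starScheme G).stN m ω).Det x) : ∀ {n}, m ≤ n → ((S.starScheme G).stN n ω).Det x := by
  intro n hmn
  induction n with
  | zero => rwa [Nat.le_zero.1 hmn] at hx
  | succ n ih =>
    rcases Nat.lt_or_eq_of_le hmn with h | h
    · have hn := ih (Nat.lt_succ_iff.1 h)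
      rcases next_cases_run (S := S) (G := G) ω n with hD | ⟨e, hc, -, hD⟩
      · rwa [(step_none_run hD).2.2.2]
      · rw [(step_some_run hc hD).2.2.2]; exact HSiteScheme.HState.det_update_of_det _ _ _ hn
    · rwa [← h]

/-- Occupied cells stay occupied. [folklore] -/
theorem occ_mono_run {ω : BondConfig V} {x : Site 2} {m : ℕ} (hx : x ∈ ((S.starScheme G).stN m ω).occ) : ∀ {n}, m ≤ n → x ∈ ((S.starScheme G).stN n ω).occ := by
  intro n hmn
  induction n with
  | zero => rwa [Nat.le_zero.1 hmn] at hx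
  | succ n ih =>
    rcases Nat.lt_or_eq_of_le hmn with h | h
    · have hn := ih (Nat.lt_succ_iff.1 h)
      rcases next_cases_run (S := S) (G := G) ω n with hD | ⟨e, hc, -, hD⟩
      · rwa [(step_none_run hD).2.2.2]
      · rw [(step_some_run hc hD).2.2.2]; exact HSiteScheme.HState.occ_subset_update _ _ _ hn
    · rwa [← h]

/-- **The data of a determined cell are frozen**: a determined cell is never a target again. [folklore] -/
theorem data_eq_of_det_run {ω : BondConfig V} {m : ℕ} {x : Site 2} (hx : ((S.starScheme G).stN m ω).Det x) :
    ∀ {n}, m ≤ n → (S.sst G ω n).anc x = (S.sst G ω m).anc x ∧ (S.sst G ω n).srcs x = (S.sst G ω m).srcs x ∧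
      (S.sst G ω n).pat x = (S.sst G ω m).pat x ∧ (S.sst G ω n).ons x = (S.sst G ω m).ons x ∧ (S.sst G ω n).J x = (S.sst G ω m).J x := by
  intro n hmn
  induction n with
  | zero => rw [Nat.le_zero.1 hmn]; exact ⟨rfl, rfl, rfl, rfl, rfl⟩
  | succ n ih =>
    rcases Nat.lt_or_eq_of_le hmn with h | h
    · have hmn' : m ≤ n := Nat.lt_succ_iff.1 h
      obtain ⟨h1, h2, h3, h4, h5⟩ := ih hmn'
      rcases next_cases_run (S := S) (G := G) ω n with hD | ⟨e, hc, -, hD⟩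
      · rw [(step_none_run hD).2.2.1]; exact ⟨h1, h2, h3, h4, h5⟩
      · have hne : x ≠ tgt e := by
          rintro rfl; exact (HSiteScheme.HState.cand_of_choice hc).2 (det_mono_run hx hmn')
        obtain ⟨k1, k2, k3, k4, k5⟩ := data_step_of_ne_run hc hD hne
        exact ⟨k1.trans h1, k2.trans h2, k3.trans h3, k4.trans h4, k5.trans h5⟩
    · subst h; exact ⟨rfl, rfl, rfl, rfl, rfl⟩

/-- The root cell is occupied throughout. [folklore] -/
theorem root_cell_occ (ω : BondConfig V) (n : ℕ) : (0 : Site 2) ∈ ((S.starScheme G).stN n ω).occ :=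
  occ_mono_run (m := 0) (by rw [stN_eq_sst]; exact Finset.mem_singleton_self _) (Nat.zero_le n)

/-- The initial data of the replay. [folklore] -/
theorem sst_zero_run (ω : BondConfig V) : S.sst G ω 0 = S.sInit G := rfl

end Sch

end StarScheme

end Transplant

end Summit.CriticalPhenomena.PercolationContinuityZ3.Theorems

end
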